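import Summits.AtomisticToContinuum.FouriersLaw.Theses.EmbeddedDrudeMourre
import Literature.MathematicalPhysics.KineticTheory.InfiniteChainSuperstableDynamics
import Literature.MathematicalPhysics.KineticTheory.InfiniteChainInvariantStates

/-!
# Canonicity of the Abel functional — `stub_canonicalSeed` of line `temperature-blind-vitali-hurwitz`
(crux `EmbeddedDrudeMourre.GreenKuboContinuation`, item stmt-AtomisticToContinuum-12597; `--supports` helper
file: proves the registered stub `stub_canonicalSeed` of the REV-2 skeleton — the lead re-registered the
stub in the regular-witness form proved here after wave 1 showed the rev-1 form (arbitrary witness)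
needs the identification facts F1/F2 below; the identification is now the separate registered stub
`stub_witnessRegularisation`, and DLR uniqueness in the regular class the stub `stub_regularDLRUnique`)

HISTORY (rev 1, kept for the record).

The registered stub `stub_canonicalSeed` asks: for a regular thermal family `(μ, D)` of
`P = pinnedChain ω₂ lam β γ` (`D.carrier = P.bmGood`) and `T > 0`, an ARBITRARY Abelian
Green–Kubo witness `(μT, D', κ)` at `T` (any DLR state `μT`, any `μT`-preserving dynamics `D'`)
forces the CANONICAL Abel functional `T⁻² ∫₀^∞ e^{-νt} C_{D, μ T}(t) dt` to converge to some
`κ' > 0`. That needs two identifications, neither of which is tree content: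

* **F1 (state)** `μT = μ T` — DLR uniqueness. Among ALL DLR states this is false-prone
  (non-tempered states); in the shift-invariant superstable class it is the printed 1-D uniqueness
  theorem (Dobrushin 1974; Cassandro–Olivieri–Pellegrinotti–Presutti 1978), NOT vendored. As a
  signature: `∀ T > 0, ∀ μ₁ μ₂, P.IsChainGibbsMeasure T μ₁ → IsShiftInvariant μ₁ →
  P.HasSuperstabilityEstimate μ₁ → P.IsChainGibbsMeasure T μ₂ → IsShiftInvariant μ₂ →
  P.HasSuperstabilityEstimate μ₂ → μ₁ = μ₂` (hypothesis `hF1` of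
  `canonicalSeed_of_regularWitness` below).
* **F2 (flow)** `D'.flow t = D.flow t` `μT`-a.e. for every `t`. By the `unique` field of `D`
  (carrier `bmGood`) this holds at every point of `D'.carrier` whose whole `D'`-orbit lies in
  `bmGood` (`flow_eq_of_orbit_subset`), in particular everywhere on `D'.carrier` when
  `D'.carrier ⊆ bmGood` (`flow_eq_of_carrier_subset`). WITHOUT that inclusion, measure
  preservation and `μT(bmGoodᶜ) = 0` (BM (2.6), superstable `μT`) only give "for each fixed `t`,
  a.e. orbit is in `bmGood` at time `t`" (`ae_mem_flow_of_preservesMeasure`) and its countable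
  upgrade (`ae_forall_countable_mem_flow_of_preservesMeasure`); the passage to ALL `t` inside the
  a.e. set — `∀ᵐ σ ∂μT, ∀ t, D'.flow t σ ∈ bmGood` — is the missing piece (no joint measurability,
  no a priori bound for arbitrary solutions in the structure `InfiniteChainDynamics`), and its
  truth at this generality is doubtful.

What IS proved here (sorry-free, general chain `P` unless stated):
* §1 flow canonicity on a sub-carrier (`flow_eq_of_orbit_subset`, `flow_eq_of_carrier_subset`);
* §2 a.e. consequences of `PreservesMeasure` (`ae_flow_eq_of_preservesMeasure`,
  `ae_mem_flow_of_preservesMeasure`, `ae_forall_countable_mem_flow_of_preservesMeasure`,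
  `measure_compl_bmGood_eq_zero_pinnedChain`);
* §3 congruence of the Green–Kubo objects under a.e. agreement of the flows
  (`currentCorrelation_congr_ae`, `hasAbsConvergentCorrelation_congr_ae`, `abelFunctional_congr`);
* §4 transfer of a witness carried by the same state (`tendsto_abel_of_carrier_subset`,
  `hasAbsConvergentCorrelation_of_carrier_subset`);
* §5 the two honest reshapings of the stub: `canonicalSeed_of_canonicalState` (witness on the
  canonical state `μ T` with `D'.carrier ⊆ bmGood`: PROVED outright) and
  `canonicalSeed_of_regularWitness` (witness state shift-invariant and superstable,
  `D'.carrier ⊆ bmGood`, with F1 as an explicit hypothesis: PROVED; = the registered stub with the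
  witness class restricted, fact-conditional on F1).
-/

noncomputable section

namespace Summit.AtomisticToContinuum.FouriersLaw.Theorems.GreenKuboContinuation.TemperatureBlindVitaliHurwitz

open Filter Topology MeasureTheory Set
open Literature.MathematicalPhysics.KineticTheory.HeatConduction

/-! ## §1 Flow canonicity on a sub-carrier (the `unique` field of `InfiniteChainDynamics`) -/

/-- **Flow canonicity along an orbit.** If `σ ∈ D'.carrier` and the whole `D'`-orbit of `σ` lies
in `D.carrier`, then `D'.flow t σ = D.flow t σ` for all `t` (the `D'`-orbit is a solution with
values in `D.carrier`, hence an orbit of `D` by `D.unique`, and `D'.flow 0 σ = σ`). [folklore] -/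
theorem flow_eq_of_orbit_subset {P : OscillatorChain} (D D' : InfiniteChainDynamics P)
    {σ : ChainConfig} (hσ : σ ∈ D'.carrier) (horb : ∀ t : ℝ, D'.flow t σ ∈ D.carrier) (t : ℝ) :
    D'.flow t σ = D.flow t σ := by
  have h := D.unique (fun u => D'.flow u σ) horb (D'.isSolution σ hσ) t
  simpa only [D'.flow_zero σ hσ] using h

/-- **Flow canonicity on a sub-carrier.** If `D'.carrier ⊆ D.carrier` then the two flows agree on
`D'.carrier` at all times. [folklore] -/
theorem flow_eq_of_carrier_subset {P : OscillatorChain} (D D' : InfiniteChainDynamics P)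
    (hsub : D'.carrier ⊆ D.carrier) {σ : ChainConfig} (hσ : σ ∈ D'.carrier) (t : ℝ) :
    D'.flow t σ = D.flow t σ :=
  flow_eq_of_orbit_subset D D' hσ (fun u => hsub (D'.flow_mem hσ u)) t

/-- The Buttà–Marchioro instance: if `D.carrier = bmGood P` and `D'.carrier ⊆ bmGood P`, then
`D'.flow t σ = D.flow t σ` for every `σ ∈ D'.carrier` and every `t`. [folklore] -/
theorem flow_eq_of_carrier_subset_bmGood {P : OscillatorChain} (D D' : InfiniteChainDynamics P)
    (hD : D.carrier = P.bmGood) (hD' : D'.carrier ⊆ P.bmGood) {σ : ChainConfig}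
    (hσ : σ ∈ D'.carrier) (t : ℝ) : D'.flow t σ = D.flow t σ :=
  flow_eq_of_carrier_subset D D' (hD.symm ▸ hD') hσ t

/-! ## §2 Almost-everywhere consequences of `PreservesMeasure` -/

/-- If `D'` preserves `μ` (so `μ`-a.e. point is in `D'.carrier`) and `D'.carrier ⊆ D.carrier`,
then for every `t` the flows agree `μ`-a.e. [folklore] -/
theorem ae_flow_eq_of_preservesMeasure {P : OscillatorChain} (D D' : InfiniteChainDynamics P)
    (hsub : D'.carrier ⊆ D.carrier) {μ : Measure ChainConfig} (hμ : D'.PreservesMeasure μ)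
    (t : ℝ) : ∀ᵐ σ ∂μ, D'.flow t σ = D.flow t σ := by
  filter_upwards [hμ.1] with σ hσ using flow_eq_of_carrier_subset D D' hsub hσ t

/-- The general a.e. form: if `μ`-a.e. `σ` lies in `D'.carrier` with its whole `D'`-orbit in
`D.carrier`, then for every `t` the flows agree `μ`-a.e. (this is how F2 would be consumed; the
hypothesis is exactly the unproved part of F2 when `D'.carrier ⊄ D.carrier`). [folklore] -/
theorem ae_flow_eq_of_ae_orbit_subset {P : OscillatorChain} (D D' : InfiniteChainDynamics P)
    {μ : Measure ChainConfig}
    (h : ∀ᵐ σ ∂μ, σ ∈ D'.carrier ∧ ∀ t : ℝ, D'.flow t σ ∈ D.carrier) (t : ℝ) :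
    ∀ᵐ σ ∂μ, D'.flow t σ = D.flow t σ := by
  filter_upwards [h] with σ hσ using flow_eq_of_orbit_subset D D' hσ.1 hσ.2 t

/-- FIXED-TIME half of F2 (provable): if `D'` preserves `μ` and `μ Sᶜ = 0`, then for each fixed
`t`, `μ`-a.e. `σ` has `D'.flow t σ ∈ S` (`φ_t` is measure preserving, so the preimage of the null
set `Sᶜ` is null; no measurability of `S` needed). [folklore] -/
theorem ae_mem_flow_of_preservesMeasure {P : OscillatorChain} (D' : InfiniteChainDynamics P)
    {μ : Measure ChainConfig} (hμ : D'.PreservesMeasure μ) {S : Set ChainConfig} (hS : μ Sᶜ = 0)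
    (t : ℝ) : ∀ᵐ σ ∂μ, D'.flow t σ ∈ S := by
  have h0 : μ ((D'.flow t) ⁻¹' Sᶜ) = 0 := (hμ.2 t).preimage_null hS
  rw [ae_iff]
  exact h0

/-- COUNTABLE-TIME upgrade of the fixed-time half of F2 (provable): along any countable family of
times, `μ`-a.e. orbit is in `S` at all those times. The registered stub would need this with
`∀ t : ℝ` inside the a.e. set, which does not follow (uncountable intersection). [folklore] -/
theorem ae_forall_countable_mem_flow_of_preservesMeasure {P : OscillatorChain}
    (D' : InfiniteChainDynamics P) {μ : Measure ChainConfig} (hμ : D'.PreservesMeasure μ)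
    {S : Set ChainConfig} (hS : μ Sᶜ = 0) {ι : Type*} [Countable ι] (τ : ι → ℝ) :
    ∀ᵐ σ ∂μ, ∀ i : ι, D'.flow (τ i) σ ∈ S :=
  ae_all_iff.2 fun i => ae_mem_flow_of_preservesMeasure D' hμ hS (τ i)

/-- BM (2.6) for the tree's pinned chain (proved in tree as `ButtaMarchioro2016_eq26_chain_holds`):
a state obeying the superstability estimate gives full measure to `bmGood`. [cite: ButtaMarchioro2016, §2 eq. (2.6)] -/
theorem measure_compl_bmGood_eq_zero_pinnedChain {ω₂ lam β : ℝ} (γ : ℝ) (hω : 0 ≤ ω₂)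
    (hl : 0 < lam) (hβ : 0 < β) {μ : Measure ChainConfig}
    (hμ : (pinnedChain ω₂ lam β γ).HasSuperstabilityEstimate μ) :
    μ ((pinnedChain ω₂ lam β γ).bmGood)ᶜ = 0 :=
  (OscillatorChain.ButtaMarchioro2016_eq26_chain_holds (pinnedChain ω₂ lam β γ) 2 2 (by norm_num)
    (by norm_num) (OscillatorChain.pinnedChain_isEvenPolyOfDegree_U β γ hω hl)
    (OscillatorChain.pinnedChain_isEvenPolyOfDegree_V ω₂ lam γ hβ) μ hμ).2

/-- Hence, for a superstable state of the pinned chain preserved by ANY dynamics `D'`: at each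
fixed time, a.e. orbit sits in `bmGood` (the provable shadow of F2). [folklore] -/
theorem ae_mem_bmGood_flow_pinnedChain {ω₂ lam β : ℝ} (γ : ℝ) (hω : 0 ≤ ω₂) (hl : 0 < lam)
    (hβ : 0 < β) (D' : InfiniteChainDynamics (pinnedChain ω₂ lam β γ)) {μ : Measure ChainConfig}
    (hμ : D'.PreservesMeasure μ) (hss : (pinnedChain ω₂ lam β γ).HasSuperstabilityEstimate μ)
    (t : ℝ) : ∀ᵐ σ ∂μ, D'.flow t σ ∈ (pinnedChain ω₂ lam β γ).bmGood :=
  ae_mem_flow_of_preservesMeasure D' hμ (measure_compl_bmGood_eq_zero_pinnedChain γ hω hl hβ hss) t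

/-! ## §3 Congruence of the Green–Kubo objects under a.e. agreement of the flows -/

/-- If `D'.flow t = D.flow t` `μ`-a.e., the summed current autocorrelations at time `t` coincide
(`integral_congr_ae` inside the `tsum`). [folklore] -/
theorem currentCorrelation_congr_ae {P : OscillatorChain} (D D' : InfiniteChainDynamics P)
    (μ : Measure ChainConfig) (t : ℝ) (h : ∀ᵐ σ ∂μ, D'.flow t σ = D.flow t σ) :
    D'.currentCorrelation μ t = D.currentCorrelation μ t := by
  unfold InfiniteChainDynamics.currentCorrelation
  refine tsum_congr fun x => integral_congr_ae ?_
  filter_upwards [h] with σ hσ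
  rw [hσ]

/-- If `D'.flow t = D.flow t` `μ`-a.e., absolute convergence of the correlation sum at time `t`
transfers. [folklore] -/
theorem hasAbsConvergentCorrelation_congr_ae {P : OscillatorChain} (D D' : InfiniteChainDynamics P)
    (μ : Measure ChainConfig) (t : ℝ) (h : ∀ᵐ σ ∂μ, D'.flow t σ = D.flow t σ) :
    D'.HasAbsConvergentCorrelation μ t ↔ D.HasAbsConvergentCorrelation μ t := by
  have hx : ∀ x : ℤ, (fun σ => P.bondCurrentZ σ 0 * P.bondCurrentZ (D'.flow t σ) x) =ᵐ[μ]
      (fun σ => P.bondCurrentZ σ 0 * P.bondCurrentZ (D.flow t σ) x) := fun x => by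
    filter_upwards [h] with σ hσ
    rw [hσ]
  have hint : ∀ x : ℤ, ∫ σ, P.bondCurrentZ σ 0 * P.bondCurrentZ (D'.flow t σ) x ∂μ =
      ∫ σ, P.bondCurrentZ σ 0 * P.bondCurrentZ (D.flow t σ) x ∂μ := fun x =>
    integral_congr_ae (hx x)
  unfold InfiniteChainDynamics.HasAbsConvergentCorrelation
  simp only [hint]
  exact and_congr_left fun _ => forall_congr' fun x => integrable_congr (hx x)

/-- If the current autocorrelations of `(D', μ)` and `(D, μ)` coincide at all times, their
`T⁻²`-normalised Abel functionals are the same function of `ν`. [folklore] -/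
theorem abelFunctional_congr {P : OscillatorChain} (D D' : InfiniteChainDynamics P)
    (μ : Measure ChainConfig) (hC : ∀ t : ℝ, D'.currentCorrelation μ t = D.currentCorrelation μ t)
    (T : ℝ) :
    (fun ν : ℝ => (T ^ 2)⁻¹ *
        ∫ t in Ioi (0:ℝ), Real.exp (-(ν * t)) * D'.currentCorrelation μ t) =
      fun ν : ℝ => (T ^ 2)⁻¹ *
        ∫ t in Ioi (0:ℝ), Real.exp (-(ν * t)) * D.currentCorrelation μ t := by
  simp only [hC]

/-! ## §4 Transfer of a witness carried by the same state -/

/-- Same state, sub-carrier: the current autocorrelations coincide at all times. [folklore] -/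
theorem currentCorrelation_eq_of_carrier_subset {P : OscillatorChain}
    (D D' : InfiniteChainDynamics P) (hsub : D'.carrier ⊆ D.carrier) {μ : Measure ChainConfig}
    (hμ : D'.PreservesMeasure μ) (t : ℝ) :
    D'.currentCorrelation μ t = D.currentCorrelation μ t :=
  currentCorrelation_congr_ae D D' μ t (ae_flow_eq_of_preservesMeasure D D' hsub hμ t)

/-- Same state, sub-carrier: absolute convergence of the correlations transfers from `D'` to `D`.
[folklore] -/
theorem hasAbsConvergentCorrelation_of_carrier_subset {P : OscillatorChain}
    (D D' : InfiniteChainDynamics P) (hsub : D'.carrier ⊆ D.carrier) {μ : Measure ChainConfig}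
    (hμ : D'.PreservesMeasure μ) {t : ℝ} (h : D'.HasAbsConvergentCorrelation μ t) :
    D.HasAbsConvergentCorrelation μ t :=
  (hasAbsConvergentCorrelation_congr_ae D D' μ t (ae_flow_eq_of_preservesMeasure D D' hsub hμ t)).1 h

/-- **Abel-limit transfer.** Same state, sub-carrier: the Abel limit of `(D', μ)` is the Abel
limit of `(D, μ)`, with the same `κ`. [folklore] -/
theorem tendsto_abel_of_carrier_subset {P : OscillatorChain} (D D' : InfiniteChainDynamics P)
    (hsub : D'.carrier ⊆ D.carrier) {μ : Measure ChainConfig} (hμ : D'.PreservesMeasure μ)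
    {T κ : ℝ}
    (hlim : Tendsto (fun ν : ℝ => (T ^ 2)⁻¹ *
        ∫ t in Ioi (0:ℝ), Real.exp (-(ν * t)) * D'.currentCorrelation μ t) (𝓝[>] 0) (𝓝 κ)) :
    Tendsto (fun ν : ℝ => (T ^ 2)⁻¹ *
        ∫ t in Ioi (0:ℝ), Real.exp (-(ν * t)) * D.currentCorrelation μ t) (𝓝[>] 0) (𝓝 κ) := by
  rw [← abelFunctional_congr D D' μ (currentCorrelation_eq_of_carrier_subset D D' hsub hμ) T]
  exact hlim

/-- **Abel-limit transfer, a.e.-orbit form** (how the full F2 would be consumed): if `μ`-a.e.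
`σ` lies in `D'.carrier` with its whole `D'`-orbit in `D.carrier`, the Abel limit of `(D', μ)` is
the Abel limit of `(D, μ)`. [folklore] -/
theorem tendsto_abel_of_ae_orbit_subset {P : OscillatorChain} (D D' : InfiniteChainDynamics P)
    {μ : Measure ChainConfig}
    (h : ∀ᵐ σ ∂μ, σ ∈ D'.carrier ∧ ∀ t : ℝ, D'.flow t σ ∈ D.carrier) {T κ : ℝ}
    (hlim : Tendsto (fun ν : ℝ => (T ^ 2)⁻¹ *
        ∫ t in Ioi (0:ℝ), Real.exp (-(ν * t)) * D'.currentCorrelation μ t) (𝓝[>] 0) (𝓝 κ)) :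
    Tendsto (fun ν : ℝ => (T ^ 2)⁻¹ *
        ∫ t in Ioi (0:ℝ), Real.exp (-(ν * t)) * D.currentCorrelation μ t) (𝓝[>] 0) (𝓝 κ) := by
  rw [← abelFunctional_congr D D' μ
    (fun t => currentCorrelation_congr_ae D D' μ t (ae_flow_eq_of_ae_orbit_subset D D' h t)) T]
  exact hlim

/-! ## §5 The two honest reshapings of `stub_canonicalSeed` -/

/-- **Reshaping A (PROVED): witness on the canonical state.** For `(μ, D)` with
`D.carrier = bmGood P` and `T > 0`: a witness `(D', κ)` carried by the canonical state `μ T`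
itself, with `D'.carrier ⊆ bmGood P`, makes the canonical Abel functional converge (to the same
`κ > 0`). Only `D.carrier = bmGood` of the regular-family block is used. [folklore] -/
theorem canonicalSeed_of_canonicalState :
    ∀ ω₂ lam β γ : ℝ, 0 < ω₂ → 0 < lam → 0 < β → 0 < γ →
      ∀ (μ : ℝ → Measure ChainConfig) (D : InfiniteChainDynamics (pinnedChain ω₂ lam β γ)),
        D.carrier = (pinnedChain ω₂ lam β γ).bmGood →
        ∀ T : ℝ, 0 < T →
          (∃ (D' : InfiniteChainDynamics (pinnedChain ω₂ lam β γ)) (κ : ℝ),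
              D'.carrier ⊆ (pinnedChain ω₂ lam β γ).bmGood ∧ D'.PreservesMeasure (μ T) ∧
              (∀ t : ℝ, D'.HasAbsConvergentCorrelation (μ T) t) ∧ 0 < κ ∧
              Tendsto (fun ν : ℝ => (T ^ 2)⁻¹ *
                ∫ t in Ioi (0:ℝ), Real.exp (-(ν * t)) * D'.currentCorrelation (μ T) t)
                (𝓝[>] 0) (𝓝 κ)) →
          ∃ κ : ℝ, 0 < κ ∧
            Tendsto (fun ν : ℝ => (T ^ 2)⁻¹ *
              ∫ t in Ioi (0:ℝ), Real.exp (-(ν * t)) * D.currentCorrelation (μ T) t)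
              (𝓝[>] 0) (𝓝 κ) := by
  intro ω₂ lam β γ _ _ _ _ μ D hD T _ hW
  obtain ⟨D', κ, hD', hP, -, hκ, hlim⟩ := hW
  exact ⟨κ, hκ, tendsto_abel_of_carrier_subset D D' (hD.symm ▸ hD') hP hlim⟩

/-- **Reshaping B (PROVED modulo F1, taken as the explicit hypothesis `hF1`): regular witnesses.**
The registered stub with the witness class RESTRICTED to shift-invariant superstable DLR states
and dynamics with `D'.carrier ⊆ bmGood P`, and with DLR uniqueness in the shift-invariant
superstable class at `T` (F1: Dobrushin 1974 / Cassandro–Olivieri–Pellegrinotti–Presutti 1978,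
1-D finite-range superstable; NOT in tree) as a hypothesis. Proof: F1 gives `μT = μ T`, then
Reshaping A. This is the corrected signature proposed for re-registration (drop `hF1` once the
uniqueness theorem is vendored and discharged). [folklore] -/
theorem canonicalSeed_of_regularWitness :
    ∀ ω₂ lam β γ : ℝ, 0 < ω₂ → 0 < lam → 0 < β → 0 < γ →
      ∀ (μ : ℝ → Measure ChainConfig) (D : InfiniteChainDynamics (pinnedChain ω₂ lam β γ)),
        (D.carrier = (pinnedChain ω₂ lam β γ).bmGood ∧
          ∀ T : ℝ, 0 < T →
            (pinnedChain ω₂ lam β γ).IsChainGibbsMeasure T (μ T) ∧ IsShiftInvariant (μ T) ∧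
            (pinnedChain ω₂ lam β γ).HasSuperstabilityEstimate (μ T) ∧ D.PreservesMeasure (μ T) ∧
            (∀ t : ℝ, D.HasAbsConvergentCorrelation (μ T) t) ∧
            (∀ ν : ℝ, 0 < ν →
              0 < ∫ t in Ioi (0:ℝ), Real.exp (-(ν * t)) * D.currentCorrelation (μ T) t)) →
        ∀ T : ℝ, 0 < T →
          (∀ μ₁ μ₂ : Measure ChainConfig,
            (pinnedChain ω₂ lam β γ).IsChainGibbsMeasure T μ₁ → IsShiftInvariant μ₁ →
            (pinnedChain ω₂ lam β γ).HasSuperstabilityEstimate μ₁ →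
            (pinnedChain ω₂ lam β γ).IsChainGibbsMeasure T μ₂ → IsShiftInvariant μ₂ →
            (pinnedChain ω₂ lam β γ).HasSuperstabilityEstimate μ₂ → μ₁ = μ₂) →
          (∃ (μT : Measure ChainConfig) (D' : InfiniteChainDynamics (pinnedChain ω₂ lam β γ))
              (κ : ℝ),
              (pinnedChain ω₂ lam β γ).IsChainGibbsMeasure T μT ∧ IsShiftInvariant μT ∧
              (pinnedChain ω₂ lam β γ).HasSuperstabilityEstimate μT ∧
              D'.carrier ⊆ (pinnedChain ω₂ lam β γ).bmGood ∧ D'.PreservesMeasure μT ∧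
              (∀ t : ℝ, D'.HasAbsConvergentCorrelation μT t) ∧ 0 < κ ∧
              Tendsto (fun ν : ℝ => (T ^ 2)⁻¹ *
                ∫ t in Ioi (0:ℝ), Real.exp (-(ν * t)) * D'.currentCorrelation μT t)
                (𝓝[>] 0) (𝓝 κ)) →
          ∃ κ : ℝ, 0 < κ ∧
            Tendsto (fun ν : ℝ => (T ^ 2)⁻¹ *
              ∫ t in Ioi (0:ℝ), Real.exp (-(ν * t)) * D.currentCorrelation (μ T) t)
              (𝓝[>] 0) (𝓝 κ) := by
  intro ω₂ lam β γ hω hl hβ hγ μ D hreg T hT hF1 hW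
  obtain ⟨μT, D', κ, hG, hS, hss, hD', hP, hAC, hκ, hlim⟩ := hW
  obtain ⟨hGT, hST, hssT, -⟩ := hreg.2 T hT
  have hμ : μT = μ T := hF1 μT (μ T) hG hS hss hGT hST hssT
  subst hμ
  exact canonicalSeed_of_canonicalState ω₂ lam β γ hω hl hβ hγ μ D hreg.1 T hT
    ⟨D', κ, hD', hP, hAC, hκ, hlim⟩

/-- The registered stub (rev 2), closed by `canonicalSeed_of_regularWitness`. [folklore] -/
theorem stub_canonicalSeed :
    ∀ ω₂ lam β γ : ℝ, 0 < ω₂ → 0 < lam → 0 < β → 0 < γ →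
      ∀ (μ : ℝ → MeasureTheory.Measure
            Literature.MathematicalPhysics.KineticTheory.HeatConduction.ChainConfig)
        (D : Literature.MathematicalPhysics.KineticTheory.HeatConduction.InfiniteChainDynamics
          (Literature.MathematicalPhysics.KineticTheory.HeatConduction.pinnedChain ω₂ lam β γ)),
        (D.carrier =
            (Literature.MathematicalPhysics.KineticTheory.HeatConduction.pinnedChain
              ω₂ lam β γ).bmGood ∧
          ∀ T : ℝ, 0 < T →
            (Literature.MathematicalPhysics.KineticTheory.HeatConduction.pinnedChain
                ω₂ lam β γ).IsChainGibbsMeasure T (μ T) ∧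
            Literature.MathematicalPhysics.KineticTheory.HeatConduction.IsShiftInvariant (μ T) ∧
            (Literature.MathematicalPhysics.KineticTheory.HeatConduction.pinnedChain
                ω₂ lam β γ).HasSuperstabilityEstimate (μ T) ∧
            D.PreservesMeasure (μ T) ∧
            (∀ t : ℝ, D.HasAbsConvergentCorrelation (μ T) t) ∧
            (∀ ν : ℝ, 0 < ν →
              0 < MeasureTheory.integral (MeasureTheory.volume.restrict (Set.Ioi (0:ℝ)))
                (fun t : ℝ => Real.exp (-(ν * t)) * D.currentCorrelation (μ T) t))) →
        ∀ T : ℝ, 0 < T →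
          (∀ μ₁ μ₂ : MeasureTheory.Measure
              Literature.MathematicalPhysics.KineticTheory.HeatConduction.ChainConfig,
            (Literature.MathematicalPhysics.KineticTheory.HeatConduction.pinnedChain
                ω₂ lam β γ).IsChainGibbsMeasure T μ₁ →
            Literature.MathematicalPhysics.KineticTheory.HeatConduction.IsShiftInvariant μ₁ →
            (Literature.MathematicalPhysics.KineticTheory.HeatConduction.pinnedChain
                ω₂ lam β γ).HasSuperstabilityEstimate μ₁ →
            (Literature.MathematicalPhysics.KineticTheory.HeatConduction.pinnedChain
                ω₂ lam β γ).IsChainGibbsMeasure T μ₂ →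
            Literature.MathematicalPhysics.KineticTheory.HeatConduction.IsShiftInvariant μ₂ →
            (Literature.MathematicalPhysics.KineticTheory.HeatConduction.pinnedChain
                ω₂ lam β γ).HasSuperstabilityEstimate μ₂ → μ₁ = μ₂) →
          (∃ (μT : MeasureTheory.Measure
                Literature.MathematicalPhysics.KineticTheory.HeatConduction.ChainConfig)
            (D' : Literature.MathematicalPhysics.KineticTheory.HeatConduction.InfiniteChainDynamics
              (Literature.MathematicalPhysics.KineticTheory.HeatConduction.pinnedChain ω₂ lam β γ))
            (κ : ℝ),
            (Literature.MathematicalPhysics.KineticTheory.HeatConduction.pinnedChain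
                ω₂ lam β γ).IsChainGibbsMeasure T μT ∧
            Literature.MathematicalPhysics.KineticTheory.HeatConduction.IsShiftInvariant μT ∧
            (Literature.MathematicalPhysics.KineticTheory.HeatConduction.pinnedChain
                ω₂ lam β γ).HasSuperstabilityEstimate μT ∧
            D'.carrier ⊆
              (Literature.MathematicalPhysics.KineticTheory.HeatConduction.pinnedChain
                ω₂ lam β γ).bmGood ∧
            D'.PreservesMeasure μT ∧
            (∀ t : ℝ, D'.HasAbsConvergentCorrelation μT t) ∧ 0 < κ ∧
            Filter.Tendsto (fun ν : ℝ => (T ^ 2)⁻¹ *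
              MeasureTheory.integral (MeasureTheory.volume.restrict (Set.Ioi (0:ℝ)))
                (fun t : ℝ => Real.exp (-(ν * t)) * D'.currentCorrelation μT t))
              (nhdsWithin (0:ℝ) (Set.Ioi 0)) (nhds κ)) →
          ∃ κ : ℝ, 0 < κ ∧
            Filter.Tendsto (fun ν : ℝ => (T ^ 2)⁻¹ *
              MeasureTheory.integral (MeasureTheory.volume.restrict (Set.Ioi (0:ℝ)))
                (fun t : ℝ => Real.exp (-(ν * t)) * D.currentCorrelation (μ T) t))
              (nhdsWithin (0:ℝ) (Set.Ioi 0)) (nhds κ) :=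
  canonicalSeed_of_regularWitness

end Summit.AtomisticToContinuum.FouriersLaw.Theorems.GreenKuboContinuation.TemperatureBlindVitaliHurwitz

end
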